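import Mathlib.Tactic.Linarith
import Mathlib.Tactic.NormNum
import Mathlib.Tactic.Ring
import HarnessLib

/-!
# The (0,1) cell of the ι-window, XXXIV (companion C): the product ground `B₁ × B₂`, XXI — THE CORNER V, ADDENDUM 2: LEMMA ET² (double elementary
# transforms of constant families along `S` never produce a type-1 partner in the window) (report [XXXIV] `H2-ZERO-ONE-34.md` §14): arithmetic shadows

Family `hodge`, b2b cell `hweil` (helper of item stmt-HodgeConjecture-2524). Report
`run/shared/lean/b2b/hodge-weil/b2b-hweil-pv1-g46/H2-ZERO-ONE-34.md` ([XXXIV]) §14 (ADDENDUM 2). Context: READING ET² of [XXXIV] 7.4 proposed the bundles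
`𝓠 = elm_S(elm_S(p₁^*N ⊗ p₂^*E₀))` (`N ≡ 6θ₁`, `E₀` semistable of rank 2 and degree 4 on `C₂`) as candidates for (Q-RES-ss), with line-bundle quotients `L_i` on
`S = C₁ × C₂` of bidegrees `(x_i, y_i)` and the Chern conditions `x₁ + x₂ = 44`, `y₁ + y₂ = 46` (type 1). The Whitney formula on `S` adds, at each step, the condition
`c₂(V|_S) = c₁(ker)·c₁(quotient)`: at step 1 it reads `(12 + r)(4 − b) + b(12 − r) = 48`, forcing `r = 0` unless `b = 2`; at step 2 it reads `(x₂ − 11)(y₂ − 2) = 2 − b₁`.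
The theorems below record these identities and the resulting Diophantine impossibility (`20b₁ = 922`) resp. the unique strictly-semistable solution `(x₂, y₂) = (11, 44)`,
whose destabilising sub has `a₁ = x₂ − 2 = 9 < 17` (outside THEOREM AJ-RIB's window). None of the theorems claims geometry. HONEST FRAMING: census work inside the
ladder's H2 test ((0,1) cell) on the SPECIAL fourfold `X₀`; nothing here is a rung; no case of the Hodge conjecture is proved; no statement of [Markman 2025] / [Perry 2026] /
[EdGFS 2025] is used.
-/

-- mandated namespace `Summit.HodgeConjecture.HodgeConjecture.…` (Problem = Summit) trips `linter.dupNamespace`; the lakefile disables it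
-- tree-wide (weak option), restated here so stand-alone elaboration is warning-free too.
set_option linter.dupNamespace false

namespace Summit.HodgeConjecture.HodgeConjecture.WeilTypeLadder

section ProductGroundTwentyOneAddTwo

/-- **[XXXIV] 14.1 (a) (Whitney at the first transform).** A line-bundle quotient of `M ⊠ E₀` on `S` (`deg M = 12`, `deg E₀ = 4`, `c₂(M ⊠ E₀) = 48`) of bidegree `(12 + r, b)`
has kernel of bidegree `(12 − r, 4 − b)`, and `c₁(ker)·c₁(quot) = (12 + r)(4 − b) + b(12 − r) = 48 + 2r(2 − b)`; so Whitney's `= 48` with `r ≥ 0`, `b ≥ 3` forces `r = 0`.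
[`ring` / `mul_eq_zero`] -/
theorem pg21f_whitney_step1 :
    (∀ r b : ℤ, (12 + r) * (4 - b) + b * (12 - r) = 48 + 2 * r * (2 - b)) ∧
    (∀ r b : ℤ, 0 ≤ r → 3 ≤ b → (12 + r) * (4 - b) + b * (12 - r) = 48 → r = 0) := by
  refine ⟨fun r b => by ring, fun r b hr hb h => ?_⟩
  have h2 : r * (b - 2) = 0 := by linarith
  rcases mul_eq_zero.mp h2 with h3 | h3
  · exact h3
  · omega

/-- **[XXXIV] 14.1 (b) (Whitney at the second transform).** With `c₁(𝓖₁|_S) = (22, 4)` and `c₂(𝓖₁|_S) = 40 + 2b₁`, a line-bundle quotient of bidegree `(x₂, y₂)` satisfies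
`(22 − x₂)y₂ + x₂(4 − y₂) = 40 + 2b₁`, equivalently `(x₂ − 11)(y₂ − 2) = 2 − b₁`; and then `c₂(𝓠|_S) = (x₂ − 2)(4 − y₂) + y₂(22 − x₂) = 32 + 2b₁ + 2y₂` (= 124 when
`b₁ + y₂ = 46`). [`linarith` on monomials] -/
theorem pg21f_whitney_step2 :
    (∀ x₂ y₂ b₁ : ℤ, ((22 - x₂) * y₂ + x₂ * (4 - y₂) = 40 + 2 * b₁) ↔ ((x₂ - 11) * (y₂ - 2) = 2 - b₁)) ∧
    (∀ x₂ y₂ b₁ : ℤ, (22 - x₂) * y₂ + x₂ * (4 - y₂) = 40 + 2 * b₁ →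
        (x₂ - 2) * (4 - y₂) + y₂ * (22 - x₂) = 32 + 2 * b₁ + 2 * y₂) ∧
    ((32 : ℤ) + 2 * 46 = 124) := by
  refine ⟨fun x₂ y₂ b₁ => ⟨fun h => by linarith, fun h => by linarith⟩, fun x₂ y₂ b₁ h => by linarith, by norm_num⟩

/-- **[XXXIV] 14.2 (LEMMA ET², type 1: the Diophantine conclusion).** Stable `E₀` (`b₁ ≥ 3`, hence `x₁ = 12`): the type-1 conditions give `x₂ = 32`, `y₂ = 46 − b₁`, and
Whitney at step 2 would need `21(44 − b₁) = 2 − b₁`, i.e. `20b₁ = 922` — no integer solution. Strictly semistable `E₀` with `b₁ = 2` (`x₁ = 12 + r₁` free): then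
`(x₂ − 11)(y₂ − 2) = 0` with `y₂ = 44` forces `x₂ = 11`, `r₁ = 21`, and the destabilising sub of `𝓠|_S` has `a₁ = x₂ − 2 = 9`, outside the window `[17, 21]` — EMPTY for
(0,1) by AJ-RIB (A). [`omega`] -/
theorem pg21f_et2_type1 :
    (∀ b₁ : ℤ, 21 * (44 - b₁) ≠ 2 - b₁) ∧
    (∀ x₂ r₁ : ℤ, (x₂ - 11) * (44 - 2) = 2 - 2 → x₂ = 44 - (12 + r₁) → x₂ = 11 ∧ r₁ = 21 ∧ x₂ - 2 < 17) := by
  refine ⟨fun b₁ h => by omega, fun x₂ r₁ h hx => ?_⟩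
  refine ⟨by omega, by omega, by omega⟩

end ProductGroundTwentyOneAddTwo

end Summit.HodgeConjecture.HodgeConjecture.WeilTypeLadder
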